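import Mathlib
import Literature.MathematicalPhysics.StatisticalMechanics.BarlowStacking
import Literature.MathematicalPhysics.StatisticalMechanics.LennardJonesClusters
import Literature.MathematicalPhysics.StatisticalMechanics.MuGroundStateConfiguration
import Summits.AtomisticToContinuum.Crystallization.Theorems.PricedLinkCensusTruncatedCensusGapSuperstableRedistribution
import Summits.AtomisticToContinuum.Crystallization.Theorems.PricedLinkCensusTruncatedCensusGapSeparatedReductionAux

/-!
# The separated reduction of the sharp m-potential

Stub `stub_separatedReduction` of the line `sharp-m-potential-compactness` for the crux
`PricedLinkCensus.TruncatedCensusGap` (item stmt-AtomisticToContinuum-14230), registered by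
`ledger skeleton check` on `Cruxes/TruncatedCensusGap/Lines/sharp_m_potential_compactness.lean`.
The final statement is the registered signature VERBATIM (self-contained over tree declarations):
`SharpLocalisationSeparated → SuperstableRedistribution94 → SharpLocalisation`.

Given a sharp m-potential `Hs` on UNIFORMLY `1/4`-SEPARATED finite injective configurations
(radius `R ≥ 9/4`, energy `e₀`; domination `Σ Hs ≤ E_χ − N e₀`, `Hs ≥ 0`, patch-locality at
`R − 1/4`, matching-continuity at `R`, near-Barlow zero set with `9a/2 ≤ R`, cluster clause) and the
superstability redistribution `F` at radius `9/4` (patch-local, `Σ F = 0`, `F = 0` on `1/4`-tame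
`9/4`-patches, crowd-free comparison through the crowd-free sub-configuration `y ∘ f`, floor `1` at
`1/4`-crowded sites), the sharp m-potential on ALL finite injective configurations is
`H N y i := Σ_{i' : f i' = i} (Hs M (y ∘ f) i' − e^{cf}_{i'}/2 + e₀) + e_i/2 + F_i − e₀`
(`f : Fin M ↪ Fin N` enumerating the `1/4`-crowd-free sites, `e_i`, `e^{cf}_{i'}` the site
energies of `V_χ` in `y` and in `y ∘ f`; the fibre sum has one term at a crowd-free site and none
at a crowded one), with `r₀ = 1/4`, `M₀ = 1` and the same `R`, `e₀`.  Domination: fibre sums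
re-index to `Σ_{i'}`, `Σ e_i/2 = E_χ(y)`, `Σ e^{cf}/2 = E_χ(y ∘ f)`, `Σ F = 0`, domination of `Hs`
on the separated `y ∘ f`.  Positivity and floor: the redistribution's two inequalities and
`e₀ ≤ 0` (one-point configuration).  Locality at `R`: `F` is `9/4`-local, site energies of the
range-`2` potential transport along the isometric correspondence (`siteEnergy_eq_of_isometry`),
crowd-freeness is decided within `1/4` and the crowd-free sub-configurations correspond at radius
`R − 1/4` (`sub_range_transport`), where `Hs` is local.  Continuity and zero set on `1/4`-tame
`R`-patches: there `F_i = 0`, `e_i = e^{cf}`, so `H_i = Hs(y ∘ f)` which, by locality of `Hs` at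
`R − 1/4`, equals `Hs` at the root of the separated RESTRICTION `z` of `y` to the closed `R`-patch
(`exists_tame_restrict`); bijective matchings of `R`-patches are bijective matchings of the
restrictions, and near-Barlow data at radius `4a` pass back to `y` since `9a/2 ≤ R`.
-/

noncomputable section

namespace Summit.AtomisticToContinuum.Crystallization.Theorems.PricedLinkCensusTruncatedCensusGap

open scoped BigOperators Classical
open Literature.MathematicalPhysics.StatisticalMechanics

/-- **The separated reduction** (registered signature, line `sharp-m-potential-compactness` of
`PricedLinkCensus.TruncatedCensusGap`): a sharp m-potential on `1/4`-separated finite injective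
configurations together with the superstability redistribution at radius `9/4` yields a sharp
m-potential on all finite injective configurations (same radius and energy, `r₀ = 1/4`,
`M₀ = 1`). [folklore] -/
theorem stub_separatedReduction :
    (
    ∃ (R e₀ : ℝ) (H : (N : ℕ) → (Fin N → EuclideanSpace ℝ (Fin 3)) → Fin N → ℝ), 9 / 4 ≤ R ∧
      (∀ (N : ℕ) (y : Fin N → EuclideanSpace ℝ (Fin 3)), Function.Injective y →
        (∀ j k : Fin N, j ≠ k → 1 / 4 ≤ dist (y j) (y k)) →
        ∑ i, H N y i ≤
          interactionEnergy (fun r => min 1 (max 0 (4 - 2 * r)) * lennardJones r) y - (N : ℝ) * e₀) ∧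
      (∀ (N : ℕ) (y : Fin N → EuclideanSpace ℝ (Fin 3)) (i : Fin N), Function.Injective y →
        (∀ j k : Fin N, j ≠ k → 1 / 4 ≤ dist (y j) (y k)) → 0 ≤ H N y i) ∧
      (∀ (N N' : ℕ) (y : Fin N → EuclideanSpace ℝ (Fin 3)) (y' : Fin N' → EuclideanSpace ℝ (Fin 3))
          (i : Fin N) (i' : Fin N')
          (g : EuclideanSpace ℝ (Fin 3) ≃ᵃⁱ[ℝ] EuclideanSpace ℝ (Fin 3)),
        Function.Injective y → Function.Injective y' →
        (∀ j k : Fin N, j ≠ k → 1 / 4 ≤ dist (y j) (y k)) →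
        (∀ j k : Fin N', j ≠ k → 1 / 4 ≤ dist (y' j) (y' k)) →
        g (y i) = y' i' →
        (∀ j : Fin N, dist (y j) (y i) ≤ R - 1 / 4 → g (y j) ∈ Set.range y') →
        (∀ j' : Fin N', dist (y' j') (y' i') ≤ R - 1 / 4 → y' j' ∈ g '' Set.range y) →
        H N y i = H N' y' i') ∧
      (∀ ε : ℝ, 0 < ε → ∃ θ : ℝ, 0 < θ ∧
        ∀ (N N' : ℕ) (y : Fin N → EuclideanSpace ℝ (Fin 3)) (y' : Fin N' → EuclideanSpace ℝ (Fin 3))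
          (i : Fin N) (i' : Fin N')
          (g : EuclideanSpace ℝ (Fin 3) ≃ᵃⁱ[ℝ] EuclideanSpace ℝ (Fin 3)),
          Function.Injective y → Function.Injective y' →
          (∀ j k : Fin N, j ≠ k → 1 / 4 ≤ dist (y j) (y k)) →
          (∀ j k : Fin N', j ≠ k → 1 / 4 ≤ dist (y' j) (y' k)) →
          g (y i) = y' i' →
          (∃ e : {j : Fin N // dist (y j) (y i) ≤ R} ≃ {j' : Fin N' // dist (y' j') (y' i') ≤ R},
            ∀ j, dist (g (y j.1)) (y' (e j).1) ≤ θ) →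
          |H N y i - H N' y' i'| ≤ ε) ∧
      (∀ (N : ℕ) (y : Fin N → EuclideanSpace ℝ (Fin 3)) (i : Fin N), Function.Injective y →
        (∀ j k : Fin N, j ≠ k → 1 / 4 ≤ dist (y j) (y k)) →
        H N y i = 0 → ∀ δ : ℝ, 0 < δ →
          ∃ (a c : ℝ) (s : ℤ → ℤ) (g : EuclideanSpace ℝ (Fin 3) ≃ᵃⁱ[ℝ] EuclideanSpace ℝ (Fin 3)),
            0 < a ∧ 9 / 2 * a ≤ R ∧ 812 / 1000 * a ≤ c ∧ c ≤ 821 / 1000 * a ∧ IsHaggSeq s ∧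
            (∀ j k : Fin N, j ≠ k → dist (y j) (y i) ≤ 4 * a → a / 2 ≤ dist (y j) (y k)) ∧
            BallMatch (δ * a) (4 * a) (y i) (Set.range y) (g '' barlowStacking a c s)) ∧
      (∀ ε : ℝ, 0 < ε → ∃ (N : ℕ) (y : Fin N → EuclideanSpace ℝ (Fin 3)), 0 < N ∧
        Function.Injective y ∧
        interactionEnergy (fun r => min 1 (max 0 (4 - 2 * r)) * lennardJones r) y ≤ (N : ℝ) * (e₀ + ε))) →
    (∃ F : (N : ℕ) → (Fin N → EuclideanSpace ℝ (Fin 3)) → Fin N → ℝ,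
      (∀ (N N' : ℕ) (y : Fin N → EuclideanSpace ℝ (Fin 3)) (y' : Fin N' → EuclideanSpace ℝ (Fin 3))
          (i : Fin N) (i' : Fin N')
          (g : EuclideanSpace ℝ (Fin 3) ≃ᵃⁱ[ℝ] EuclideanSpace ℝ (Fin 3)),
        Function.Injective y → Function.Injective y' → g (y i) = y' i' →
        (∀ j : Fin N, dist (y j) (y i) ≤ 9 / 4 → g (y j) ∈ Set.range y') →
        (∀ j' : Fin N', dist (y' j') (y' i') ≤ 9 / 4 → y' j' ∈ g '' Set.range y) →
        F N y i = F N' y' i') ∧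
      (∀ (N : ℕ) (y : Fin N → EuclideanSpace ℝ (Fin 3)), Function.Injective y → ∑ i, F N y i = 0) ∧
      (∀ (N : ℕ) (y : Fin N → EuclideanSpace ℝ (Fin 3)) (i : Fin N), Function.Injective y →
        (∀ j k : Fin N, j ≠ k → dist (y j) (y i) ≤ 9 / 4 → dist (y k) (y i) ≤ 9 / 4 →
          1 / 4 ≤ dist (y j) (y k)) →
        F N y i = 0) ∧
      (∀ (N M : ℕ) (y : Fin N → EuclideanSpace ℝ (Fin 3)) (f : Fin M ↪ Fin N) (i : Fin M),
        Function.Injective y →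
        (∀ k : Fin N, k ∈ Set.range f ↔ ∀ k' : Fin N, k' ≠ k → 1 / 4 ≤ dist (y k') (y k)) →
        siteEnergy (fun r => min 1 (max 0 (4 - 2 * r)) * lennardJones r) (y ∘ f) i / 2 ≤
          siteEnergy (fun r => min 1 (max 0 (4 - 2 * r)) * lennardJones r) y (f i) / 2
            + F N y (f i)) ∧
      (∀ (N : ℕ) (y : Fin N → EuclideanSpace ℝ (Fin 3)) (i : Fin N), Function.Injective y →
        ¬ (∀ k : Fin N, k ≠ i → 1 / 4 ≤ dist (y k) (y i)) →
        1 ≤ siteEnergy (fun r => min 1 (max 0 (4 - 2 * r)) * lennardJones r) y i / 2 + F N y i)) →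
    ∃ (R r₀ e₀ M₀ : ℝ) (H : (N : ℕ) → (Fin N → EuclideanSpace ℝ (Fin 3)) → Fin N → ℝ),
      0 < r₀ ∧ 0 < M₀ ∧
      (∀ (N : ℕ) (y : Fin N → EuclideanSpace ℝ (Fin 3)), Function.Injective y →
        ∑ i, H N y i ≤
          interactionEnergy (fun r => min 1 (max 0 (4 - 2 * r)) * lennardJones r) y - (N : ℝ) * e₀) ∧
      (∀ (N : ℕ) (y : Fin N → EuclideanSpace ℝ (Fin 3)) (i : Fin N), Function.Injective y →
        0 ≤ H N y i) ∧
      (∀ (N N' : ℕ) (y : Fin N → EuclideanSpace ℝ (Fin 3)) (y' : Fin N' → EuclideanSpace ℝ (Fin 3))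
          (i : Fin N) (i' : Fin N')
          (g : EuclideanSpace ℝ (Fin 3) ≃ᵃⁱ[ℝ] EuclideanSpace ℝ (Fin 3)),
        Function.Injective y → Function.Injective y' → g (y i) = y' i' →
        (∀ j : Fin N, dist (y j) (y i) ≤ R → g (y j) ∈ Set.range y') →
        (∀ j' : Fin N', dist (y' j') (y' i') ≤ R → y' j' ∈ g '' Set.range y) →
        H N y i = H N' y' i') ∧
      (∀ ε : ℝ, 0 < ε → ∃ θ : ℝ, 0 < θ ∧
        ∀ (N N' : ℕ) (y : Fin N → EuclideanSpace ℝ (Fin 3)) (y' : Fin N' → EuclideanSpace ℝ (Fin 3))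
          (i : Fin N) (i' : Fin N')
          (g : EuclideanSpace ℝ (Fin 3) ≃ᵃⁱ[ℝ] EuclideanSpace ℝ (Fin 3)),
          Function.Injective y → Function.Injective y' →
          (∀ j k : Fin N, j ≠ k → dist (y j) (y i) ≤ R → dist (y k) (y i) ≤ R →
            r₀ ≤ dist (y j) (y k)) →
          (∀ j k : Fin N', j ≠ k → dist (y' j) (y' i') ≤ R → dist (y' k) (y' i') ≤ R →
            r₀ ≤ dist (y' j) (y' k)) →
          g (y i) = y' i' →
          (∃ e : {j : Fin N // dist (y j) (y i) ≤ R} ≃ {j' : Fin N' // dist (y' j') (y' i') ≤ R},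
            ∀ j, dist (g (y j.1)) (y' (e j).1) ≤ θ) →
          |H N y i - H N' y' i'| ≤ ε) ∧
      (∀ (N : ℕ) (y : Fin N → EuclideanSpace ℝ (Fin 3)) (i : Fin N), Function.Injective y →
        (∀ j k : Fin N, j ≠ k → dist (y j) (y i) ≤ R → dist (y k) (y i) ≤ R →
          r₀ ≤ dist (y j) (y k)) →
        H N y i = 0 → ∀ δ : ℝ, 0 < δ →
          ∃ (a c : ℝ) (s : ℤ → ℤ) (g : EuclideanSpace ℝ (Fin 3) ≃ᵃⁱ[ℝ] EuclideanSpace ℝ (Fin 3)),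
            0 < a ∧ 4 * a ≤ R ∧ 812 / 1000 * a ≤ c ∧ c ≤ 821 / 1000 * a ∧ IsHaggSeq s ∧
            (∀ j k : Fin N, j ≠ k → dist (y j) (y i) ≤ 4 * a → a / 2 ≤ dist (y j) (y k)) ∧
            BallMatch (δ * a) (4 * a) (y i) (Set.range y) (g '' barlowStacking a c s)) ∧
      (∀ (N : ℕ) (y : Fin N → EuclideanSpace ℝ (Fin 3)) (i : Fin N), Function.Injective y →
        ¬ (∀ k : Fin N, k ≠ i → r₀ ≤ dist (y k) (y i)) → M₀ ≤ H N y i) ∧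
      (∀ ε : ℝ, 0 < ε → ∃ (N : ℕ) (y : Fin N → EuclideanSpace ℝ (Fin 3)), 0 < N ∧
        Function.Injective y ∧
        interactionEnergy (fun r => min 1 (max 0 (4 - 2 * r)) * lennardJones r) y ≤ (N : ℝ) * (e₀ + ε)) := by
  generalize hV : (fun r : ℝ => min 1 (max 0 (4 - 2 * r)) * lennardJones r) = V
  intro hS hF
  obtain ⟨R, e₀, Hs, hR, domS, nonnegS, locS, contS, zeroS, clusterS⟩ := hS
  obtain ⟨F, locF, sumF, tameF, cfF, floorF⟩ := hF
  have hV2 : ∀ r, 2 < r → V r = 0 := fun r hr => by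
    simp only [← hV]
    exact truncLJ_eq_zero hr.le
  have he₀ : e₀ ≤ 0 := e0_nonpos e₀ Hs V domS nonnegS
  -- the canonical enumeration `f N y : Fin (M N y) ↪ Fin N` of the `1/4`-crowd-free sites
  choose M f hf using fun (N : ℕ) (y : Fin N → EuclideanSpace ℝ (Fin 3)) => exists_crowdFree_enum y
  -- the m-potential
  obtain ⟨H, hH⟩ : ∃ H : (N : ℕ) → (Fin N → EuclideanSpace ℝ (Fin 3)) → Fin N → ℝ,
      ∀ N y i, H N y i = (∑ i' ∈ Finset.univ.filter (fun i' => f N y i' = i),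
        (Hs (M N y) (y ∘ f N y) i' - siteEnergy V (y ∘ f N y) i' / 2 + e₀)) +
        (siteEnergy V y i / 2 + F N y i - e₀) := ⟨fun N y i => _, fun _ _ _ => rfl⟩
  have hHcf : ∀ (N : ℕ) (y : Fin N → EuclideanSpace ℝ (Fin 3)) (i' : Fin (M N y)),
      H N y (f N y i') = Hs (M N y) (y ∘ f N y) i' +
        (siteEnergy V y (f N y i') / 2 + F N y (f N y i') - siteEnergy V (y ∘ f N y) i' / 2) := by
    intro N y i'
    rw [hH, sum_filter_embedding_eq]
    ring
  have hHncf : ∀ (N : ℕ) (y : Fin N → EuclideanSpace ℝ (Fin 3)) (i : Fin N),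
      (¬ ∀ k' : Fin N, k' ≠ i → 1 / 4 ≤ dist (y k') (y i)) →
      H N y i = siteEnergy V y i / 2 + F N y i - e₀ := by
    intro N y i hi
    rw [hH, sum_filter_embedding_eq_zero _ _ _ (mt (hf N y i).1 hi), zero_add]
  -- on a `1/4`-tame `R`-patch the m-potential is the separated one of the crowd-free sites
  have hHtame : ∀ (N : ℕ) (y : Fin N → EuclideanSpace ℝ (Fin 3)) (i' : Fin (M N y)),
      Function.Injective y →
      (∀ j k : Fin N, j ≠ k → dist (y j) (y (f N y i')) ≤ R → dist (y k) (y (f N y i')) ≤ R →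
        1 / 4 ≤ dist (y j) (y k)) →
      H N y (f N y i') = Hs (M N y) (y ∘ f N y) i' := by
    intro N y i' hy ht
    rw [hHcf, tameF N y _ hy (fun j k hjk hj hk => ht j k hjk (hj.trans hR) (hk.trans hR)),
      siteEnergy_sub_eq_of_tame V hV2 y hy (f N y) (hf N y) i' hR ht]
    ring
  refine ⟨R, 1 / 4, e₀, 1, H, by norm_num, by norm_num, ?_, ?_, ?_, ?_, ?_, ?_, clusterS⟩
  · -- domination
    intro N y hy
    have hsub := domS (M N y) (y ∘ f N y) (hy.comp (f N y).injective) (sub_separated y _ (hf N y))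
    have h2 := two_mul_interactionEnergy V (y ∘ f N y)
    have h3 := two_mul_interactionEnergy V y
    have h4 := sumF N y hy
    have hsum : ∑ i, H N y i =
        ∑ i', (Hs (M N y) (y ∘ f N y) i' - siteEnergy V (y ∘ f N y) i' / 2 + e₀) +
          ∑ i, (siteEnergy V y i / 2 + F N y i - e₀) := by
      rw [← Finset.sum_fiberwise Finset.univ (f N y)
        (fun i' => Hs (M N y) (y ∘ f N y) i' - siteEnergy V (y ∘ f N y) i' / 2 + e₀),
        ← Finset.sum_add_distrib]
      exact Finset.sum_congr rfl fun i _ => hH N y i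
    rw [hsum, Finset.sum_add_distrib, Finset.sum_sub_distrib, Finset.sum_sub_distrib,
      Finset.sum_add_distrib, ← Finset.sum_div, ← Finset.sum_div, ← h2, ← h3, h4]
    simp only [Finset.sum_const, Finset.card_univ, Fintype.card_fin, nsmul_eq_mul]
    linarith
  · -- non-negativity
    intro N y i hy
    by_cases hcf : ∀ k' : Fin N, k' ≠ i → 1 / 4 ≤ dist (y k') (y i)
    · obtain ⟨i', rfl⟩ := (hf N y i).2 hcf
      rw [hHcf]
      have h1 := nonnegS (M N y) (y ∘ f N y) i' (hy.comp (f N y).injective)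
        (sub_separated y _ (hf N y))
      have h2 := cfF N (M N y) y (f N y) i' hy (hf N y)
      linarith
    · rw [hHncf N y i hcf]
      linarith [floorF N y i hy hcf]
  · -- patch-locality at radius `R`
    intro N N' y y' i i' g hy hy' hg h1 h2
    have hF : F N y i = F N' y' i' := locF N N' y y' i i' g hy hy' hg
      (fun j hj => h1 j (hj.trans hR)) (fun j' hj' => h2 j' (hj'.trans hR))
    have hE : siteEnergy V y i = siteEnergy V y' i' := siteEnergy_eq_of_isometry V 2 hV2 y y' i i'
      g hy hy' hg (fun j hj => h1 j (by linarith)) (fun j' hj' => h2 j' (by linarith))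
    by_cases hcf : ∀ k' : Fin N, k' ≠ i → 1 / 4 ≤ dist (y k') (y i)
    · have hcf' : ∀ k' : Fin N', k' ≠ i' → 1 / 4 ≤ dist (y' k') (y' i') :=
        crowdFree_of_isometry y y' i i' g hy' hg (fun k' hk' => h2 k' (by linarith)) hcf
      obtain ⟨i₀, rfl⟩ := (hf N y i).2 hcf
      obtain ⟨i₀', rfl⟩ := (hf N' y' i').2 hcf'
      obtain ⟨h1c, h2c⟩ := sub_range_transport y y' (f N y) (f N' y') (hf N y) (hf N' y') i₀ i₀'
        g hy hy' hg (show (2 : ℝ) + 1 / 4 ≤ R by linarith) h1 h2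
      obtain ⟨h1s, h2s⟩ := sub_range_transport y y' (f N y) (f N' y') (hf N y) (hf N' y') i₀ i₀'
        g hy hy' hg (show R - 1 / 4 + 1 / 4 ≤ R by linarith) h1 h2
      rw [hHcf, hHcf, hF, hE,
        siteEnergy_eq_of_isometry V 2 hV2 (y ∘ f N y) (y' ∘ f N' y') i₀ i₀' g
          (hy.comp (f N y).injective) (hy'.comp (f N' y').injective) hg h1c h2c,
        locS (M N y) (M N' y') (y ∘ f N y) (y' ∘ f N' y') i₀ i₀' g (hy.comp (f N y).injective)
          (hy'.comp (f N' y').injective) (sub_separated y _ (hf N y))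
          (sub_separated y' _ (hf N' y')) hg h1s h2s]
    · have hcf' : ¬ ∀ k' : Fin N', k' ≠ i' → 1 / 4 ≤ dist (y' k') (y' i') := fun h =>
        hcf (crowdFree_of_isometry' y y' i i' g hy hg (fun k hk => h1 k (by linarith)) h)
      rw [hHncf N y i hcf, hHncf N' y' i' hcf', hF, hE]
  · -- tame continuity at `(R, 1/4)`
    intro ε hε
    obtain ⟨θ, hθ, hc⟩ := contS ε hε
    refine ⟨θ, hθ, fun N N' y y' i i' g hy hy' ht ht' hg he => ?_⟩
    obtain ⟨e, he⟩ := he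
    obtain ⟨i₀, rfl⟩ := (hf N y i).2 (crowdFree_of_tame y i i ht (by rw [dist_self]; linarith))
    obtain ⟨i₀', rfl⟩ := (hf N' y' i').2
      (crowdFree_of_tame y' i' i' ht' (by rw [dist_self]; linarith))
    obtain ⟨L, z, r, ez, hz, hzr, hzinj, hzsep, hzR, hHz⟩ :=
      exists_tame_restrict Hs R hR locS _ _ y hy (f N y) (hf N y) i₀ ht
    obtain ⟨L', z', r', ez', hz', hz'r, hz'inj, hz'sep, hz'R, hHz'⟩ :=
      exists_tame_restrict Hs R hR locS _ _ y' hy' (f N' y') (hf N' y') i₀' ht'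
    rw [hHtame N y i₀ hy ht, hHtame N' y' i₀' hy' ht', hHz, hHz']
    obtain ⟨e'', he''⟩ := restrict_equiv y y' _ _ z z' r r' ez ez' hz hz' hzR hz'R g e he
    exact hc L L' z z' r r' g hzinj hz'inj hzsep hz'sep (by rw [hzr, hz'r]; exact hg) ⟨e'', he''⟩
  · -- the zero set on tame patches
    intro N y i hy ht h0 δ hδ
    obtain ⟨i₀, rfl⟩ := (hf N y i).2 (crowdFree_of_tame y i i ht (by rw [dist_self]; linarith))
    obtain ⟨L, z, r, ez, hz, hzr, hzinj, hzsep, hzR, hHz⟩ :=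
      exists_tame_restrict Hs R hR locS _ _ y hy (f N y) (hf N y) i₀ ht
    rw [hHtame N y i₀ hy ht, hHz] at h0
    obtain ⟨a, c, s, g, ha, haR, hc1, hc2, hs, hsep, hmatch⟩ := zeroS L z r hzinj hzsep h0 δ hδ
    exact ⟨a, c, s, g, ha, by linarith, hc1, hc2, hs, sep_of_restrict y _ ha haR z r ez hz hzr hsep,
      ballMatch_of_restrict y _ (by linarith) z r ez hz hzr _ hmatch⟩
  · -- the floor at `1/4`-crowded sites
    intro N y i hy hcf
    rw [hHncf N y i hcf]
    linarith [floorF N y i hy hcf]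

end Summit.AtomisticToContinuum.Crystallization.Theorems.PricedLinkCensusTruncatedCensusGap

end
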